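import Summits.QuantumFields.YangMills.Theorems.AllWindowsColdBoxBoxHighLineConnectedThreePointRowsParity
import Summits.QuantumFields.YangMills.Theorems.AllWindowsColdBoxBoxHighLineConnectedFourPointRows
import Summits.QuantumFields.YangMills.Theorems.AllWindowsColdBoxBoxHighLineK3PrimeRowE2

/-!
# U5 K3′: the row decomposition of `κ₃,₀^{μ_{D′}}(c_x, c_y; tiltU)` IN THE LETTERS OF RECORD (the `hsplit` of the hK3 row-sum)

Free-hands helper of the κ-lineage (ym-line-fcl-p3 g27; planner ym-idea-2 g18 routing 2026-08-30T01:02:42Z «K3′-SPLIT skeleton + hK3 row-sum → fcl-p3»); the κ₃ twin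
of LEAD g78's ✓`GaussNormalForm.abs_tiltCum4_muSet_tiltU_le_rows` (p754020).  ✓`GaussRestrict.abs_tiltCum3_muSet_zero_le_rows₂` (rows₂, parity-refined) instantiated at
`X Y := chartPlaqCost · 1 2`, `Lz := linCurvSq (plaq12At z)`, `Xo Yo := chartPlaqCostOdd · 1 2`, `U := tiltU β H`, the cubic vertex polynomial
`P := β·Σ_{p touching} tripleForm (Tc p) (plaqVar_p ·)` (GENERIC `Tc`, `|Tc| ≤ BT`, P FIRST — LEAD's sign letters; sign-convention immune), the local cubic Taylor forms
`Cz := tripleForm T₀z (plaqVar_z ·)` (GENERIC `T₀x, T₀y`, `|T₀·| ≤ B₀` — w5 g24's E2 letters ✓`…K3PrimeRowE2`), and a GENERIC measurable even-vertex candidate `Ve` bounded on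
`D` (the assembler takes `Ve := quadVal (ghostM H) + quadVal (−(1/3)•1) − β·Σ_p Q⁴_p − β·phiQuartic` once w3 g42's quartic form `Q⁴` is in the tree; `Ve` needs NO parity):

* ★★ `GaussNormalForm.abs_tiltCum3_muSet_tiltU_le_rows` — for `0 ≤ s ≤ 1`, a measurable SYMMETRIC `D ⊆ smallField H s` with `E₀[1−1_D] ≤ τ ≤ 1/2`, `sup_D|tiltU| ≤ K`:
  `|κ₃,₀(X,Y;U)| ≤ |κ₃(Lx,Ly;Ve)| (E1) + |κ₃(Cx,Ly;P) + κ₃(Lx,Cy;P)| (E2) + |κ₃(Lx,Ly;Uᵉ−Ve)| (RA) + |κ₃(X−Lx,Y;Uᵉ) + κ₃(Lx,Y−Ly;Uᵉ)| (RB)`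
  `+ |κ₃(X−Xo,Yo;N) + κ₃(Xo,Y−Yo;N)| (RC) + |κ₃(Xo−Cx,Ly;P) + κ₃(Lx,Yo−Cy;P)| (RD) + |κ₃(Xo,Y−Ly−Yo;P) + κ₃(X−Lx−Xo,Yo;P)| (RE)`,
  `Uᵉ a := (U a + U(−a))/2`, `N a := (U a − U(−a))/2 − P a` (discharges: ✓`TiltSup.abs_chartPlaqCost_le`/`linCurvSq_le`/`sum_norm_plaqVar_le`, ✓`abs_tripleForm_le`,
  ✓`abs_chartPlaqCostOdd_le`, ✓`measurable_of_polyCert`/`polyCert_tripleFormSum`/`polyCert_tripleForm`, ✓`measurable_tiltU`, parities ✓`linCurvSq_neg`, ✓`chartPlaqCostOdd_neg`,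
  ✓`tripleFormSum_neg`);
* `GaussNormalForm.abs_tiltCum3_muSet_linCurvSq_add_third_le` — the E1 row is subadditive in the vertex (`|κ₃(Lx,Ly;V₁+V₂)| ≤ |κ₃(Lx,Ly;V₁)| + |κ₃(Lx,Ly;V₂)|`), so the
  assembler feeds it vertex by vertex (quadVal ghostM ✓p753741, Haar₂, Wilson quartic, `−β·phiQuartic`).

No definitions; standard axioms.  HONEST LABEL: helper-grade U5 prep (the `hsplit` input of the hK3 row-sum; every row's SIZE is a separate brick); U5, ⟨24004⟩, ⟨24336⟩
remain OPEN; route AllWindowsColdBox is DRAFT; no crux, rung or summit is proved; **the Yang–Mills mass gap is NOT proved by this file; no summit is proved by a line.**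
-/

set_option autoImplicit false

noncomputable section

open MeasureTheory Set

namespace Summit.QuantumFields.YangMills.Theorems.AllWindowsColdBoxBoxHighLine

namespace GaussNormalForm

open Literature.Probability.LatticeModels (Site)
open Literature.MathematicalPhysics.QuantumLattice (ZdPlaquette plaquettesTouching)
open Literature.MathematicalPhysics.QuantumFieldTheory.AxialGauge (boxEdges)
open Summit.QuantumFields.YangMills.Theorems.WeakCouplingRates (plaq12At)

/-- ★★ **U5 K3′ — the row decomposition of `κ₃,₀^{μ_{D′}}(c_x, c_y; tiltU)` in the letters of record (parity-refined rows₂), for the hK3 assembler.**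
For `0 ≤ s ≤ 1`, ANY coefficient families `Tc` (`|Tc| ≤ BT`, the cubic vertex polynomial `P := β·Σ_p tripleForm (Tc p) (plaqVar_p ·)`, P FIRST) and `T₀x, T₀y`
(`|T₀·| ≤ B₀`, the local cubic Taylor forms `Cz := tripleForm T₀z (plaqVar_z ·)` of `c_z^{odd}`), ANY measurable even-vertex candidate `Ve` bounded by `BV` on `D`, a
measurable SYMMETRIC `D ⊆ smallField H s` with `E₀[1 − 1_D] ≤ τ ≤ 1/2` and `sup_D |tiltU| ≤ K`, and all base points `x, y`:
`|κ₃,₀(X,Y;U)| ≤ |κ₃(Lx,Ly;Ve)| + |κ₃(Cx,Ly;P) + κ₃(Lx,Cy;P)| + |κ₃(Lx,Ly;Uᵉ−Ve)| + |κ₃(X−Lx,Y;Uᵉ) + κ₃(Lx,Y−Ly;Uᵉ)| + |κ₃(X−Xo,Yo;N) + κ₃(Xo,Y−Yo;N)|`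
`+ |κ₃(Xo−Cx,Ly;P) + κ₃(Lx,Yo−Cy;P)| + |κ₃(Xo,Y−Ly−Yo;P) + κ₃(X−Lx−Xo,Yo;P)|`
with `X Y := chartPlaqCost · 1 2`, `Lz := linCurvSq (plaq12At z)`, `Xo Yo := chartPlaqCostOdd · 1 2`, `U := tiltU β H`, `Uᵉ a := (U a + U(−a))/2`, `N a := (U a − U(−a))/2 − P a`
(✓`GaussRestrict.abs_tiltCum3_muSet_zero_le_rows₂`; parities ✓`linCurvSq_neg`, ✓`chartPlaqCostOdd_neg`, ✓`tripleFormSum_neg`). -/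
theorem abs_tiltCum3_muSet_tiltU_le_rows (H : ℕ) {β : ℝ} (hβ : 0 < β) {s : ℝ} (hs0 : 0 ≤ s) (hs1 : s ≤ 1)
    (BT : ℝ) (Tc : ZdPlaquette 4 → Fin 4 → Fin 4 → Fin 4 → ℝ) (hT : ∀ p i j k, |Tc p i j k| ≤ BT)
    (B₀ : ℝ) (T₀x T₀y : Fin 4 → Fin 4 → Fin 4 → ℝ) (hT₀x : ∀ i j k, |T₀x i j k| ≤ B₀) (hT₀y : ∀ i j k, |T₀y i j k| ≤ B₀)
    {D : Set (LandauFree H → E3)} (hDm : MeasurableSet D) (hDs : D ⊆ smallField H s) (hsym : ∀ a, -a ∈ D ↔ a ∈ D)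
    {Ve : (LandauFree H → E3) → ℝ} (mVe : Measurable Ve) {BV : ℝ} (bVe : ∀ a ∈ D, |Ve a| ≤ BV)
    {K : ℝ} (hK : 0 ≤ K) (hUK : ∀ a ∈ D, |tiltU β H a| ≤ K)
    {τ : ℝ} (hτ : gaussAvg β H (fun a => 1 - D.indicator (fun _ => (1 : ℝ)) a) ≤ τ) (hτ2 : τ ≤ 1 / 2) (x y : Site 4) :
    let μD : Measure (LandauFree H → E3) := (((volume : Measure (LandauFree H → E3)).restrict D).withDensity fun a => ENNReal.ofReal (gaussWeight β H a))
    let X : (LandauFree H → E3) → ℝ := chartPlaqCost H x 1 2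
    let Y : (LandauFree H → E3) → ℝ := chartPlaqCost H y 1 2
    let U : (LandauFree H → E3) → ℝ := tiltU β H
    let P : (LandauFree H → E3) → ℝ := fun a => β * ∑ p ∈ plaquettesTouching (boxEdges 4 (2 * H + 1)), tripleForm (Tc p) (plaqVar H p.1 p.2.1.1 p.2.1.2 a)
    let Lx : (LandauFree H → E3) → ℝ := linCurvSq H (plaq12At x)
    let Ly : (LandauFree H → E3) → ℝ := linCurvSq H (plaq12At y)
    let Xo : (LandauFree H → E3) → ℝ := chartPlaqCostOdd H x 1 2
    let Yo : (LandauFree H → E3) → ℝ := chartPlaqCostOdd H y 1 2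
    let Cx : (LandauFree H → E3) → ℝ := fun a => tripleForm T₀x (plaqVar H x 1 2 a)
    let Cy : (LandauFree H → E3) → ℝ := fun a => tripleForm T₀y (plaqVar H y 1 2 a)
    let Ue : (LandauFree H → E3) → ℝ := fun a => (U a + U (-a)) / 2
    let N : (LandauFree H → E3) → ℝ := fun a => (U a - U (-a)) / 2 - P a
    let Re : (LandauFree H → E3) → ℝ := fun a => (U a + U (-a)) / 2 - Ve a
    |Tilt.tiltCum3 μD U 0 X Y| ≤
      |Tilt.tiltCum3 μD Ve 0 Lx Ly| +
      |Tilt.tiltCum3 μD P 0 Cx Ly + Tilt.tiltCum3 μD P 0 Lx Cy| +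
      |Tilt.tiltCum3 μD Re 0 Lx Ly| +
      |Tilt.tiltCum3 μD Ue 0 (fun a => X a - Lx a) Y + Tilt.tiltCum3 μD Ue 0 Lx (fun a => Y a - Ly a)| +
      |Tilt.tiltCum3 μD N 0 (fun a => X a - Xo a) Yo + Tilt.tiltCum3 μD N 0 Xo (fun a => Y a - Yo a)| +
      |Tilt.tiltCum3 μD P 0 (fun a => Xo a - Cx a) Ly + Tilt.tiltCum3 μD P 0 Lx (fun a => Yo a - Cy a)| +
      |Tilt.tiltCum3 μD P 0 Xo (fun a => Y a - Ly a - Yo a) + Tilt.tiltCum3 μD P 0 (fun a => X a - Lx a - Xo a) Yo| := by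
  intro μD X Y U P Lx Ly Xo Yo Cx Cy
  set PT := plaquettesTouching (boxEdges 4 (2 * H + 1)) with hPT
  have hD := GaussRestrict.integral_indicator_mul_gaussWeight_pos hβ hDm hτ hτ2
  -- one common bound on `D`
  set B : ℝ := 116 + 16 + 4 + K + |BV| + |β * PT.card * (6 * BT * (4 * s) ^ 3)| + |6 * B₀ * (4 * s) ^ 3| with hB
  have habs₁ := abs_nonneg (β * PT.card * (6 * BT * (4 * s) ^ 3))
  have habs₂ := abs_nonneg (6 * B₀ * (4 * s) ^ 3)
  have habs₃ := abs_nonneg BV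
  have hB0 : 0 ≤ B := by rw [hB]; linarith
  have hs2 : s ^ 2 ≤ 1 := pow_le_one₀ hs0 hs1
  have bX : ∀ z : Site 4, ∀ a ∈ D, |chartPlaqCost H z 1 2 a| ≤ B := fun z a ha =>
    (TiltSup.abs_chartPlaqCost_le hs0 hs1 (hDs ha) z 1 2).trans (by rw [hB]; nlinarith)
  have bL : ∀ z : Site 4, ∀ a ∈ D, |linCurvSq H (plaq12At z) a| ≤ B := fun z a ha => by
    have h1 : linCurvSq H (plaq12At z) a ≤ 16 * s ^ 2 := TiltSup.linCurvSq_le hs0 (hDs ha) z 1 2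
    have h0 : 0 ≤ linCurvSq H (plaq12At z) a := Finset.sum_nonneg fun c _ => sq_nonneg _
    rw [abs_of_nonneg h0, hB]; nlinarith
  have bO : ∀ z : Site 4, ∀ a ∈ D, |chartPlaqCostOdd H z 1 2 a| ≤ B := fun z a _ =>
    (EdgeChartGaussian.abs_chartPlaqCostOdd_le H z 1 2 a).trans (by rw [hB]; linarith)
  have bU : ∀ a ∈ D, |U a| ≤ B := fun a ha => (hUK a ha).trans (by rw [hB]; linarith)
  have bU' : ∀ a ∈ D, |U (-a)| ≤ B := fun a ha => (hUK (-a) ((hsym a).2 ha)).trans (by rw [hB]; linarith)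
  have bVeB : ∀ a ∈ D, |Ve a| ≤ B := fun a ha => ((bVe a ha).trans (le_abs_self BV)).trans (by rw [hB]; linarith)
  have bP : ∀ a ∈ D, |P a| ≤ B := by
    intro a ha
    show |β * ∑ p ∈ PT, tripleForm (Tc p) (plaqVar H p.1 p.2.1.1 p.2.1.2 a)| ≤ B
    rw [abs_mul, abs_of_pos hβ]
    have hterm : ∀ p ∈ PT, |tripleForm (Tc p) (plaqVar H p.1 p.2.1.1 p.2.1.2 a)| ≤ 6 * BT * (4 * s) ^ 3 := by
      intro p _
      refine (EdgeChartGaussian.abs_tripleForm_le (Tc p) (hT p) _).trans ?_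
      have hBT : 0 ≤ BT := (abs_nonneg _).trans (hT p 0 0 0)
      exact mul_le_mul_of_nonneg_left (pow_le_pow_left₀ (Finset.sum_nonneg fun i _ => norm_nonneg _)
        (TiltSup.sum_norm_plaqVar_le hs0 (hDs ha) p.1 p.2.1.1 p.2.1.2) 3) (by positivity)
    have hsum : |∑ p ∈ PT, tripleForm (Tc p) (plaqVar H p.1 p.2.1.1 p.2.1.2 a)| ≤ PT.card * (6 * BT * (4 * s) ^ 3) := by
      refine (Finset.abs_sum_le_sum_abs _ _).trans ((Finset.sum_le_sum hterm).trans (le_of_eq ?_))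
      rw [Finset.sum_const, nsmul_eq_mul]
    calc β * |∑ p ∈ PT, tripleForm (Tc p) (plaqVar H p.1 p.2.1.1 p.2.1.2 a)| ≤ β * (PT.card * (6 * BT * (4 * s) ^ 3)) :=
          mul_le_mul_of_nonneg_left hsum hβ.le
      _ = β * PT.card * (6 * BT * (4 * s) ^ 3) := by ring
      _ ≤ B := (le_abs_self _).trans (by rw [hB]; linarith)
  have bC : ∀ (z : Site 4) (T₀ : Fin 4 → Fin 4 → Fin 4 → ℝ), (∀ i j k, |T₀ i j k| ≤ B₀) → ∀ a ∈ D, |tripleForm T₀ (plaqVar H z 1 2 a)| ≤ B := by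
    intro z T₀ hT₀ a ha
    have hB₀ : 0 ≤ B₀ := (abs_nonneg _).trans (hT₀ 0 0 0)
    have h1 : |tripleForm T₀ (plaqVar H z 1 2 a)| ≤ 6 * B₀ * (4 * s) ^ 3 :=
      (EdgeChartGaussian.abs_tripleForm_le T₀ hT₀ _).trans (mul_le_mul_of_nonneg_left
        (pow_le_pow_left₀ (Finset.sum_nonneg fun i _ => norm_nonneg _) (TiltSup.sum_norm_plaqVar_le hs0 (hDs ha) z 1 2) 3) (by positivity))
    exact (h1.trans (le_abs_self _)).trans (by rw [hB]; linarith)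
  -- measurability
  have mP : Measurable P := EdgeChartGaussian.measurable_of_polyCert (EdgeChartGaussian.polyCert_tripleFormSum H β PT Tc hT)
  have mCx : Measurable Cx := EdgeChartGaussian.measurable_of_polyCert (EdgeChartGaussian.polyCert_tripleForm x 1 2 T₀x hT₀x)
  have mCy : Measurable Cy := EdgeChartGaussian.measurable_of_polyCert (EdgeChartGaussian.polyCert_tripleForm y 1 2 T₀y hT₀y)
  -- parities
  have pL : ∀ z : Site 4, ∀ a, linCurvSq H (plaq12At z) (-a) = linCurvSq H (plaq12At z) a := fun z a => EdgeChartGaussian.linCurvSq_neg (plaq12At z) a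
  have pO : ∀ z : Site 4, ∀ a, chartPlaqCostOdd H z 1 2 (-a) = -chartPlaqCostOdd H z 1 2 a := fun z a => EdgeChartGaussian.chartPlaqCostOdd_neg z 1 2 a
  have pP : ∀ a, P (-a) = -P a := fun a => EdgeChartGaussian.tripleFormSum_neg H β PT Tc a
  have pE : ∀ z : Site 4, ∀ a, chartPlaqCost H z 1 2 (-a) - chartPlaqCostOdd H z 1 2 (-a) = chartPlaqCost H z 1 2 a - chartPlaqCostOdd H z 1 2 a := by
    intro z a; unfold chartPlaqCostOdd; rw [neg_neg]; ring
  exact GaussRestrict.abs_tiltCum3_muSet_zero_le_rows₂ hβ hDm hsym hD hB0 (EdgeChartGaussian.measurable_chartPlaqCost H x 1 2)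
    (EdgeChartGaussian.measurable_chartPlaqCost H y 1 2) (measurable_tiltU β H) mP mVe (EdgeChartGaussian.measurable_linCurvSq H (plaq12At x))
    (EdgeChartGaussian.measurable_linCurvSq H (plaq12At y)) mCx mCy (EdgeChartGaussian.measurable_chartPlaqCostOdd H x 1 2)
    (EdgeChartGaussian.measurable_chartPlaqCostOdd H y 1 2) (bX x) (bX y) bU bU' bP bVeB (bL x) (bL y) (bC x T₀x hT₀x) (bC y T₀y hT₀y) (bO x) (bO y)
    (pL x) (pL y) (pO x) (pO y) pP (pE x) (pE y)

/-- The even-vertex row splits additively: `|κ₃(Lx,Ly;V₁+V₂)| ≤ |κ₃(Lx,Ly;V₁)| + |κ₃(Lx,Ly;V₂)|` over `μ_{D′}` (so the hK3 assembler may feed the E1 row vertex by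
vertex: `quadVal (ghostM H)`, Haar₂ `quadVal (−(1/3)•1)`, the Wilson quartic form, `−β·phiQuartic`). -/
theorem abs_tiltCum3_muSet_linCurvSq_add_third_le (H : ℕ) {β : ℝ} (hβ : 0 < β) {s : ℝ} (hs0 : 0 ≤ s)
    {D : Set (LandauFree H → E3)} (hDm : MeasurableSet D) (hDs : D ⊆ smallField H s)
    {τ : ℝ} (hτ : gaussAvg β H (fun a => 1 - D.indicator (fun _ => (1 : ℝ)) a) ≤ τ) (hτ2 : τ ≤ 1 / 2)
    {V₁ V₂ : (LandauFree H → E3) → ℝ} (m₁ : Measurable V₁) (m₂ : Measurable V₂) {BV : ℝ} (b₁ : ∀ a ∈ D, |V₁ a| ≤ BV) (b₂ : ∀ a ∈ D, |V₂ a| ≤ BV)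
    (x y : Site 4) :
    |Tilt.tiltCum3 ((((volume : Measure (LandauFree H → E3)).restrict D).withDensity fun a => ENNReal.ofReal (gaussWeight β H a))) (fun a => V₁ a + V₂ a) 0
        (linCurvSq H (plaq12At x)) (linCurvSq H (plaq12At y))| ≤
      |Tilt.tiltCum3 ((((volume : Measure (LandauFree H → E3)).restrict D).withDensity fun a => ENNReal.ofReal (gaussWeight β H a))) V₁ 0
          (linCurvSq H (plaq12At x)) (linCurvSq H (plaq12At y))| +
        |Tilt.tiltCum3 ((((volume : Measure (LandauFree H → E3)).restrict D).withDensity fun a => ENNReal.ofReal (gaussWeight β H a))) V₂ 0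
          (linCurvSq H (plaq12At x)) (linCurvSq H (plaq12At y))| := by
  have hD := GaussRestrict.integral_indicator_mul_gaussWeight_pos hβ hDm hτ hτ2
  set B : ℝ := 16 * s ^ 2 + |BV| with hB
  have habs := abs_nonneg BV
  have hB0 : 0 ≤ B := by rw [hB]; positivity
  have bL : ∀ z : Site 4, ∀ a ∈ D, |linCurvSq H (plaq12At z) a| ≤ B := fun z a ha => by
    have h1 : linCurvSq H (plaq12At z) a ≤ 16 * s ^ 2 := TiltSup.linCurvSq_le hs0 (hDs ha) z 1 2
    have h0 : 0 ≤ linCurvSq H (plaq12At z) a := Finset.sum_nonneg fun c _ => sq_nonneg _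
    rw [abs_of_nonneg h0, hB]; linarith
  have bV₁ : ∀ a ∈ D, |V₁ a| ≤ B := fun a ha => ((b₁ a ha).trans (le_abs_self BV)).trans (by rw [hB]; nlinarith [sq_nonneg s])
  have bV₂ : ∀ a ∈ D, |V₂ a| ≤ B := fun a ha => ((b₂ a ha).trans (le_abs_self BV)).trans (by rw [hB]; nlinarith [sq_nonneg s])
  rw [GaussRestrict.tiltCum3_muSet_zero_add_third hβ hDm hD hB0 (EdgeChartGaussian.measurable_linCurvSq H (plaq12At x))
    (EdgeChartGaussian.measurable_linCurvSq H (plaq12At y)) m₁ m₂ (bL x) (bL y) bV₁ bV₂]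
  exact abs_add_le _ _

end GaussNormalForm

end Summit.QuantumFields.YangMills.Theorems.AllWindowsColdBoxBoxHighLine

end
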